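import Mathlib.Analysis.Complex.HasPrimitives
import Mathlib.Analysis.SpecialFunctions.Complex.Analytic
import Mathlib.Analysis.SpecialFunctions.Complex.LogDeriv
import Mathlib.Analysis.SpecialFunctions.Trigonometric.DerivHyp
import Mathlib.Analysis.Normed.Module.Ball.Pointwise
import Mathlib.Topology.MetricSpace.Thickening
import Literature.Analysis.Complex.HolomorphicPrimitives
import Literature.Probability.LatticeModels.UrsellMonotonicityProofs
import Literature.Probability.LatticeModels.CumulantsAnalytic
import HarnessLib

/-!
# Camia–Jiang–Newman 2023, Theorem 2 from Theorem 1: the first Lee–Yang zero is antitone in `J`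

Topic `Literature/Probability/LatticeModels`; second sibling PROOF file of `UrsellMonotonicity.lean`
(after `UrsellMonotonicityProofs.lean`).  We prove

* `CamiaJiangNewman2023_thm2_of_thm1 : CamiaJiangNewman2023_thm1 → CamiaJiangNewman2023_thm2`,

i.e. the deduction printed in Camia–Jiang–Newman 2023, §1.2 (proof of Thm 2, arXiv p. 4): for
`0 ≤ c ≤ c'` and `λ ≥ 0`, every zero `h₀` of the moment generating function `⟨e^{hX}⟩_c`,
`X = Σ λ_u σ_u`, has a zero of `⟨e^{hX}⟩_{c'}` of modulus `≤ ‖h₀‖`.  The printed proof: the cumulants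
`u_k(X) = dᵏ/dhᵏ log⟨e^{hX}⟩|₀` (CJN (12)) are the Taylor coefficients of `log mgf`, whose radius of
convergence is the modulus `α₁` of the first zero (CJN (11)–(13)); `u_k(X) = Σ_j λ_{j_1}⋯λ_{j_k}
u_k(σ_j)` (CJN (14)); odd ones vanish, and by Thm 1 with Shlosman's signs `|u_{2k}(X; J)|` is
nondecreasing in `J`; so the radius is nonincreasing in `J`.  Our rendering:

* `PairIsing.differentiable_mgf`, `iteratedDeriv_mgf_zero` (`mgf^{(m)}(0) = ⟨X^m⟩_c`),
  `avg_pow_weightedMagnetization_odd` (spin flip), `cumulantOf_odd_eq_zero`, `cumulantOf_map`;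
* the analytic inputs are `iteratedDeriv_succ_eq_cumulantOf` (cumulants = Taylor coefficients of any
  local `log` of the mgf) and `ne_zero_of_norm_iteratedDeriv_le` (no zero of `mgf_c` in a disc on
  which `mgf_{c'}` has a holomorphic logarithm whose Taylor coefficients dominate) of
  `CumulantsAnalytic.lean`; the Lee–Yang theorem is NOT needed for the zero form;
* **Shlosman's sign at `J = 0`** (the base point of the monotonicity, CJN Remark 1 / eq. (6)):
  `mgf_zero_coupling` (`⟨e^{hX}⟩_0 = ∏_u cosh(λ_u h)`), the local logarithm `Σ_u log cosh(λ_u h)`,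
  `iteratedDeriv_comp_const_mul_of_analyticAt` (scaling), and the TANGENT NUMBERS:
  `iteratedDeriv_tanh_succ` (`tanh' = 1 - tanh²` differentiated at `0`) and
  `exists_iteratedDeriv_tanh_eq` (`tanh^{(n)}(0) = r_n i^{n+3}` with `r_n ≥ 0`, by the Riccati
  recursion), whence `(-1)^{k-1} (log cosh)^{(2k)}(0) ≥ 0` and
  `cumulant_weightedMagnetization_zero_coupling_nonneg`;
* `cumulant_abs_le_of_thm1` — `|κ_n(X; c)| ≤ |κ_n(X; c')|` for all `n ≥ 1`, given Thm 1;
* `exists_ball_forall_mgf_ne_zero` — a zero-free closed disc thickens to a zero-free open disc;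
* `CamiaJiangNewman2023_thm2_of_thm1` — assembly.

No definitions, no named facts; everything is proved, Thm 1 being the hypothesis.

## References

* [CamiaJiangNewman2023] F. Camia, J. Jiang, C. M. Newman, CMP 401 (2023), arXiv:2207.12247:
  Thm 1, Remark 1, Thm 2 and its proof (§1.2, eqs. (11)–(14)).
* [Shlosman1986] S. B. Shlosman, CMP 102 (1986) 679–686 (signs of Ursell functions).
-/

noncomputable section

open Finset Filter Metric Complex
open scoped Topology Nat

namespace Literature.Probability.LatticeModels

/-! ### Algebra of cumulants: parity and change of ring -/

/-- If all odd moments vanish then all odd cumulants vanish. [folklore] -/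
theorem cumulantOf_odd_eq_zero {C : Type*} [CommRing C] (μ : ℕ → C) (hμ : μ 0 = 1)
    (hodd : ∀ m, μ (2 * m + 1) = 0) (m : ℕ) : cumulantOf μ (2 * m + 1) = 0 := by
  induction m using Nat.strong_induction_on with
  | _ m ih =>
    have h := moment_succ_eq_sum_choose_mul_cumulantOf μ hμ (2 * m)
    rw [hodd, sum_range_succ, Nat.choose_self, Nat.sub_self, hμ] at h
    have hzero : ∑ k ∈ range (2 * m),
        ((2 * m).choose k : C) * cumulantOf μ (k + 1) * μ (2 * m - k) = 0 := by
      refine sum_eq_zero fun k hk => ?_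
      have hk' := mem_range.1 hk
      rcases Nat.even_or_odd' k with ⟨i, rfl | rfl⟩
      · rw [ih i (by omega)]
        ring
      · have h2 : 2 * m - (2 * i + 1) = 2 * (m - i - 1) + 1 := by omega
        rw [h2, hodd]
        ring
    rw [hzero] at h
    simpa using h.symm

/-- Cumulants commute with ring homomorphisms (they are integer polynomials in the moments).
[folklore] -/
theorem cumulantOf_map {C D : Type*} [CommRing C] [CommRing D] (g : C →+* D) (μ : ℕ → C)
    (hμ : μ 0 = 1) {n : ℕ} (hn : 0 < n) :
    cumulantOf (fun m => g (μ m)) n = g (cumulantOf μ n) := by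
  rw [cumulantOf_eq_sum_setPartitions μ hμ hn,
    cumulantOf_eq_sum_setPartitions (fun m => g (μ m)) (by simp [hμ]) hn, map_sum]
  refine sum_congr rfl fun π _ => ?_
  rw [map_mul, map_mul, map_prod, map_pow, map_neg, map_one, map_natCast]

/-- Real cumulants seen in `ℂ`. [folklore] -/
theorem cumulantOf_ofReal (μ : ℕ → ℝ) (hμ : μ 0 = 1) {n : ℕ} (hn : 0 < n) :
    cumulantOf (fun m => ((μ m : ℝ) : ℂ)) n = ((cumulantOf μ n : ℝ) : ℂ) :=
  cumulantOf_map Complex.ofRealHom μ hμ hn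

namespace PairIsing

variable {ι : Type*} [Fintype ι] [DecidableEq ι]

/-! ### The moment generating function: holomorphy, derivatives at `0`, parity -/

/-- The mgf as a normalised finite sum of exponentials `Σ_σ p_σ e^{X(σ) h}`. [folklore] -/
theorem mgf_eq (c : ι → ι → ℝ) (lam : ι → ℝ) (h : ℂ) :
    mgf c lam h = ((∑ ρ : SpinConfig ι, weight c ρ : ℝ) : ℂ)⁻¹ *
      ∑ ρ : SpinConfig ι, (weight c ρ : ℂ) * exp ((weightedMagnetization lam ρ : ℂ) * h) := by
  rw [mgf, div_eq_inv_mul]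
  congr 1
  refine sum_congr rfl fun ρ _ => ?_
  rw [mul_comm (h : ℂ), mul_comm]

/-- The moment generating function is entire. [folklore] -/
theorem differentiable_mgf (c : ι → ι → ℝ) (lam : ι → ℝ) : Differentiable ℂ (mgf c lam) := by
  have h : mgf c lam = fun h => ((∑ ρ : SpinConfig ι, weight c ρ : ℝ) : ℂ)⁻¹ *
      ∑ ρ : SpinConfig ι, (weight c ρ : ℂ) * exp ((weightedMagnetization lam ρ : ℂ) * h) :=
    funext (mgf_eq c lam)
  rw [h]
  fun_prop

/-- The moment generating function is continuous. [folklore] -/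
theorem continuous_mgf (c : ι → ι → ℝ) (lam : ι → ℝ) : Continuous (mgf c lam) :=
  (differentiable_mgf c lam).continuous

/-- **The derivatives of the mgf at `0` are the moments**: `mgf^{(m)}(0) = ⟨X^m⟩_c`. [folklore] -/
theorem iteratedDeriv_mgf_zero (c : ι → ι → ℝ) (lam : ι → ℝ) (m : ℕ) :
    iteratedDeriv m (mgf c lam) 0 =
      ((avg c (fun σ => weightedMagnetization lam σ ^ m) : ℝ) : ℂ) := by
  have h : mgf c lam = fun h => ((∑ ρ : SpinConfig ι, weight c ρ : ℝ) : ℂ)⁻¹ *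
      ∑ ρ : SpinConfig ι, (weight c ρ : ℂ) * exp ((weightedMagnetization lam ρ : ℂ) * h) :=
    funext (mgf_eq c lam)
  rw [h, iteratedDeriv_const_mul _ (by fun_prop), iteratedDeriv_fun_sum (fun ρ _ => by fun_prop)]
  have hterm : ∀ ρ : SpinConfig ι, iteratedDeriv m
      (fun h : ℂ => (weight c ρ : ℂ) * exp ((weightedMagnetization lam ρ : ℂ) * h)) 0 =
      (weight c ρ : ℂ) * (weightedMagnetization lam ρ : ℂ) ^ m := by
    intro ρ
    rw [iteratedDeriv_const_mul _ (by fun_prop)]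
    have := congrFun (iteratedDeriv_cexp_const_mul m (weightedMagnetization lam ρ : ℂ)) 0
    rw [this, mul_zero, exp_zero, mul_one]
  simp_rw [hterm]
  rw [avg, div_eq_inv_mul]
  push_cast
  congr 1
  refine sum_congr rfl fun ρ _ => ?_
  ring

omit [DecidableEq ι] in
/-- Spin flip leaves the Boltzmann weight invariant. [folklore] -/
theorem weight_neg (c : ι → ι → ℝ) (ρ : SpinConfig ι) : weight c (-ρ) = weight c ρ := by
  unfold weight
  simp [spinAt_neg]

omit [DecidableEq ι] in
/-- Spin flip reverses the weighted magnetisation. [folklore] -/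
theorem weightedMagnetization_neg (lam : ι → ℝ) (ρ : SpinConfig ι) :
    weightedMagnetization lam (-ρ) = -weightedMagnetization lam ρ := by
  unfold weightedMagnetization
  simp [spinAt_neg, sum_neg_distrib]

/-- Spin-flip invariance of the Gibbs average. [folklore] -/
theorem avg_comp_neg (c : ι → ι → ℝ) (f : SpinConfig ι → ℝ) :
    avg c (fun ρ => f (-ρ)) = avg c f := by
  unfold avg
  congr 1
  calc ∑ ρ : SpinConfig ι, f (-ρ) * weight c ρ
      = ∑ ρ : SpinConfig ι, f (-ρ) * weight c (-ρ) := by simp_rw [weight_neg]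
    _ = ∑ ρ : SpinConfig ι, f ρ * weight c ρ :=
        Fintype.sum_equiv (Equiv.neg (SpinConfig ι)) _ _ fun ρ => rfl

/-- Odd moments of `X = Σ λ_u σ_u` vanish at zero field (spin flip; CJN eq. (5)).
[cite: CamiaJiangNewman2023, §1.1 eq. (5)] -/
theorem avg_pow_weightedMagnetization_odd (c : ι → ι → ℝ) (lam : ι → ℝ) (m : ℕ) :
    avg c (fun σ => weightedMagnetization lam σ ^ (2 * m + 1)) = 0 := by
  have h := avg_comp_neg c (fun σ => weightedMagnetization lam σ ^ (2 * m + 1))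
  simp only [weightedMagnetization_neg, Odd.neg_pow ⟨m, rfl⟩, avg_def, neg_mul, sum_neg_distrib,
    neg_div] at h
  rw [avg_def]
  linarith

/-- Odd cumulants of `X` vanish (CJN: "by spin-flip symmetry, `u_k(X) = 0` if `k` is odd").
[cite: CamiaJiangNewman2023, §1.2 (proof of Thm 2)] -/
theorem cumulant_weightedMagnetization_odd (c : ι → ι → ℝ) (lam : ι → ℝ) (m : ℕ) :
    cumulantOf (fun n => avg c (fun σ => weightedMagnetization lam σ ^ n)) (2 * m + 1) = 0 :=
  cumulantOf_odd_eq_zero _ (by simp [avg_const]) (avg_pow_weightedMagnetization_odd c lam) m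

/-- A local logarithm of the mgf at `0` and its Taylor coefficients: for `Lf = log ∘ mgf`,
`Lf^{(n+1)}(0) = κ_{n+1}(X; c)`. [cite: CamiaJiangNewman2023, §1.2 eq. (12)] -/
theorem iteratedDeriv_log_mgf (c : ι → ι → ℝ) (lam : ι → ℝ) (n : ℕ) :
    iteratedDeriv (n + 1) (fun h => log (mgf c lam h)) 0 =
      ((cumulantOf (fun m => avg c (fun σ => weightedMagnetization lam σ ^ m)) (n + 1) : ℝ) : ℂ) := by
  have hf : AnalyticAt ℂ (mgf c lam) 0 := (differentiable_mgf c lam).analyticAt 0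
  have hL : AnalyticAt ℂ (fun h => log (mgf c lam h)) 0 :=
    hf.clog (by rw [mgf_zero]; exact one_mem_slitPlane)
  have hfL : ∀ᶠ z in 𝓝 0, mgf c lam z = exp (log (mgf c lam z)) := by
    have hne : ∀ᶠ z in 𝓝 (0 : ℂ), mgf c lam z ≠ 0 :=
      (continuous_mgf c lam).continuousAt.eventually_ne (by rw [mgf_zero]; exact one_ne_zero)
    filter_upwards [hne] with z hz
    rw [exp_log hz]
  rw [iteratedDeriv_succ_eq_cumulantOf hf hL hfL (mgf_zero c lam) n]
  simp_rw [iteratedDeriv_mgf_zero]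
  exact cumulantOf_ofReal _ (by simp [avg_const]) (Nat.succ_pos n)

/-! ### Zero coupling: `⟨e^{hX}⟩_0 = ∏_u cosh(λ_u h)` -/

omit [DecidableEq ι] in
/-- At zero coupling the Boltzmann weight is `1`. [folklore] -/
@[simp] theorem weight_zero_coupling (ρ : SpinConfig ι) : weight (0 : ι → ι → ℝ) ρ = 1 := by
  simp [weight]

/-- **Independent spins**: `⟨e^{hX}⟩_0 = ∏_u cosh(λ_u h)`. [folklore] -/
theorem mgf_zero_coupling (lam : ι → ℝ) (h : ℂ) :
    mgf (0 : ι → ι → ℝ) lam h = ∏ u : ι, cosh ((lam u : ℂ) * h) := by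
  rw [mgf]
  simp only [weight_zero_coupling, ofReal_one, mul_one, sum_const, card_univ, nsmul_eq_mul]
  -- numerator: `Σ_σ e^{h X(σ)} = ∏_u Σ_{s = ±1} e^{h λ_u s} = ∏_u 2 cosh(λ_u h)`
  have hnum : ∑ ρ : SpinConfig ι, exp (h * (weightedMagnetization lam ρ : ℂ)) =
      ∏ u : ι, ∑ s : ℤˣ, exp (h * (lam u : ℂ) * ((s : ℤ) : ℂ)) := by
    rw [Finset.prod_univ_sum]
    simp only [Fintype.piFinset_univ]
    refine sum_congr rfl fun ρ _ => ?_
    rw [← exp_sum]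
    congr 1
    unfold weightedMagnetization spinAt
    push_cast
    rw [mul_sum]
    refine sum_congr rfl fun u _ => ?_
    ring
  have hcard : (((Fintype.card (SpinConfig ι) : ℕ) : ℝ) : ℂ) = 2 ^ Fintype.card ι := by
    rw [Fintype.card_fun, Fintype.card_units_int]
    push_cast
    ring
  rw [hnum, hcard]
  have htwo : ∀ u : ι, ∑ s : ℤˣ, exp (h * (lam u : ℂ) * ((s : ℤ) : ℂ)) = 2 * cosh ((lam u : ℂ) * h) := by
    intro u
    rw [UnitsInt.univ, sum_insert (by decide), sum_singleton, two_cosh]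
    simp only [Units.val_one, Int.cast_one, mul_one, Units.val_neg, Int.cast_neg, mul_neg]
    ring_nf
  simp_rw [htwo]
  have h2 : (2 : ℂ) ^ Fintype.card ι ≠ 0 := pow_ne_zero _ two_ne_zero
  rw [prod_mul_distrib, prod_const, card_univ, mul_comm, mul_div_assoc, div_self h2, mul_one]

/-! ### Tangent numbers: `tanh^{(n)}(0) = r_n i^{n+3}`, `r_n ≥ 0` -/

/-- `tanh' = 1 - tanh²` where `cosh ≠ 0`. [folklore] -/
theorem hasDerivAt_tanh {z : ℂ} (hz : cosh z ≠ 0) : HasDerivAt tanh (1 - tanh z ^ 2) z := by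
  have h : tanh = fun w => sinh w / cosh w := funext tanh_eq_sinh_div_cosh
  have hd := (hasDerivAt_sinh z).div (hasDerivAt_cosh z) hz
  have heq : (cosh z * cosh z - sinh z * sinh z) / cosh z ^ 2 = 1 - tanh z ^ 2 := by
    rw [tanh_eq_sinh_div_cosh]
    field_simp
  rw [← heq, h]
  exact hd

/-- `tanh` is smooth where `cosh ≠ 0`. [folklore] -/
theorem contDiffAt_tanh {z : ℂ} (hz : cosh z ≠ 0) {n : WithTop ℕ∞} : ContDiffAt ℂ n tanh z := by
  have h : tanh = fun w => sinh w / cosh w := funext tanh_eq_sinh_div_cosh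
  rw [h]
  exact contDiff_sinh.contDiffAt.div contDiff_cosh.contDiffAt hz

/-- `cosh ≠ 0` near `0`. [folklore] -/
theorem eventually_cosh_ne_zero : ∀ᶠ z in 𝓝 (0 : ℂ), cosh z ≠ 0 :=
  continuous_cosh.continuousAt.eventually_ne (by rw [cosh_zero]; exact one_ne_zero)

/-- **The Riccati recursion for the derivatives of `tanh` at `0`**:
`tanh^{(n+1)}(0) = [n = 0] - Σ_k C(n,k) tanh^{(k)}(0) tanh^{(n-k)}(0)`. [folklore] -/
theorem iteratedDeriv_tanh_succ (n : ℕ) :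
    iteratedDeriv (n + 1) tanh 0 = (if n = 0 then (1 : ℂ) else 0) -
      ∑ k ∈ range (n + 1), (n.choose k : ℂ) * iteratedDeriv k tanh 0 * iteratedDeriv (n - k) tanh 0 := by
  have hev : deriv tanh =ᶠ[𝓝 (0 : ℂ)] (fun _ => (1 : ℂ)) - tanh * tanh := by
    filter_upwards [eventually_cosh_ne_zero] with z hz
    rw [(hasDerivAt_tanh hz).deriv]
    simp [sq]
  have h0 : cosh (0 : ℂ) ≠ 0 := by rw [cosh_zero]; exact one_ne_zero
  rw [iteratedDeriv_succ', hev.iteratedDeriv_eq n,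
    iteratedDeriv_sub (f := fun _ => (1 : ℂ)) (g := tanh * tanh) contDiffAt_const
      (by exact (contDiffAt_tanh h0).mul (contDiffAt_tanh h0)),
    iteratedDeriv_const, iteratedDeriv_mul (contDiffAt_tanh h0) (contDiffAt_tanh h0)]

/-- **Tangent numbers are nonnegative**: `tanh^{(n)}(0) = r_n · i^{n+3}` with `r_n ≥ 0` real
(`tan z = -i tanh(iz)` has nonnegative Taylor coefficients: `r_{n+1} = [n=0] + Σ_k C(n,k) r_k r_{n-k}`).
[folklore] -/
theorem exists_iteratedDeriv_tanh_eq (n : ℕ) :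
    ∃ r : ℝ, 0 ≤ r ∧ iteratedDeriv n tanh 0 = (r : ℂ) * I ^ (n + 3) := by
  induction n using Nat.strong_induction_on with
  | _ n ih =>
    rcases n with _ | n
    · exact ⟨0, le_rfl, by simp⟩
    · choose! r hr0 hr using ih
      refine ⟨(if n = 0 then (1 : ℝ) else 0) +
          ∑ k ∈ range (n + 1), (n.choose k : ℝ) * r k * r (n - k), ?_, ?_⟩
      · refine add_nonneg (by split_ifs <;> norm_num) (sum_nonneg fun k hk => ?_)
        have hk := mem_range.1 hk
        exact mul_nonneg (mul_nonneg (Nat.cast_nonneg _) (hr0 k (by omega))) (hr0 (n - k) (by omega))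
      · rw [iteratedDeriv_tanh_succ]
        have hsum : ∑ k ∈ range (n + 1),
            (n.choose k : ℂ) * iteratedDeriv k tanh 0 * iteratedDeriv (n - k) tanh 0 =
            I ^ (n + 6) * ∑ k ∈ range (n + 1), ((n.choose k : ℝ) * r k * r (n - k) : ℝ) := by
          push_cast
          rw [mul_sum]
          refine sum_congr rfl fun k hk => ?_
          have hk' := mem_range.1 hk
          rw [hr k (by omega), hr (n - k) (by omega)]
          have hpow : I ^ (k + 3) * I ^ (n - k + 3) = I ^ (n + 6) := by
            rw [← pow_add]; congr 1; omega
          calc (n.choose k : ℂ) * ((r k : ℂ) * I ^ (k + 3)) * ((r (n - k) : ℂ) * I ^ (n - k + 3))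
              = (n.choose k : ℂ) * (r k : ℂ) * (r (n - k) : ℂ) * (I ^ (k + 3) * I ^ (n - k + 3)) := by
                ring
            _ = _ := by rw [hpow]; ring
        rw [hsum]
        have hI6 : I ^ (n + 6) = -I ^ (n + 1 + 3) := by
          rw [show n + 6 = (n + 1 + 3) + 2 by ring, pow_add, I_sq]; ring
        have hI4 : (if n = 0 then (1 : ℂ) else 0) = (if n = 0 then (1 : ℝ) else 0 : ℝ) * I ^ (n + 1 + 3) := by
          split_ifs with hn
          · subst hn
            rw [show (0 + 1 + 3 : ℕ) = 4 from rfl, I_pow_four]; simp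
          · simp
        rw [hI6, hI4]
        push_cast
        ring

/-- **Shlosman's sign for one symmetric `±1` spin**: `(-1)^{k-1} (log cosh)^{(2k)}(0) ≥ 0`
(the `2k`-th cumulant of a symmetric Bernoulli variable is `tanh^{(2k-1)}(0) = r i^{2k+2}`).
[cite: CamiaJiangNewman2023, §1.1 eq. (6)] -/
theorem exists_iteratedDeriv_log_cosh_eq (k : ℕ) (hk : 1 ≤ k) :
    ∃ r : ℝ, 0 ≤ r ∧ (-1 : ℂ) ^ (k - 1) * iteratedDeriv (2 * k) (fun z => log (cosh z)) 0 = (r : ℂ) := by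
  obtain ⟨r, hr0, hr⟩ := exists_iteratedDeriv_tanh_eq (2 * k - 1)
  refine ⟨r, hr0, ?_⟩
  have hev : deriv (fun z => log (cosh z)) =ᶠ[𝓝 (0 : ℂ)] tanh := by
    have hslit : ∀ᶠ z in 𝓝 (0 : ℂ), cosh z ∈ slitPlane :=
      continuous_cosh.continuousAt.eventually (isOpen_slitPlane.mem_nhds (by simp))
    filter_upwards [hslit] with z hz
    rw [((hasDerivAt_cosh z).clog hz).deriv, tanh_eq_sinh_div_cosh]
  obtain ⟨j, rfl⟩ : ∃ j, k = j + 1 := ⟨k - 1, by omega⟩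
  rw [show 2 * (j + 1) = (2 * j + 1) + 1 by ring, iteratedDeriv_succ', hev.iteratedDeriv_eq]
  rw [show 2 * (j + 1) - 1 = 2 * j + 1 by omega] at hr
  rw [hr, Nat.add_sub_cancel]
  have hI : I ^ (2 * j + 1 + 3) = (-1 : ℂ) ^ j := by
    rw [show 2 * j + 1 + 3 = 2 * (j + 2) by ring, pow_mul, I_sq, pow_add, neg_one_sq, mul_one]
  rw [hI]
  have hsq : ((-1 : ℂ) ^ j) * ((-1 : ℂ) ^ j) = 1 := by
    rw [← mul_pow, neg_one_mul, neg_neg, one_pow]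
  linear_combination (r : ℂ) * hsq

/-! ### Scaling of Taylor coefficients and the cumulants at zero coupling -/

/-- Local scaling: for `g` analytic at `0`, `(h ↦ g(a h))^{(n)}(0) = aⁿ g^{(n)}(0)` (no global
smoothness of `g` required). [folklore] -/
theorem iteratedDeriv_comp_const_mul_of_analyticAt (n : ℕ) :
    ∀ (g : ℂ → ℂ), AnalyticAt ℂ g 0 → ∀ a : ℂ,
      iteratedDeriv n (fun h => g (a * h)) 0 = a ^ n * iteratedDeriv n g 0 := by
  induction n with
  | zero => intro g _ a; simp
  | succ n ih =>
    intro g hg a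
    have hga : ∀ᶠ h in 𝓝 (0 : ℂ), AnalyticAt ℂ g (a * h) := by
      have ht : Tendsto (fun h : ℂ => a * h) (𝓝 0) (𝓝 0) := by
        simpa using (continuous_const_mul a).tendsto (0 : ℂ)
      exact ht.eventually hg.eventually_analyticAt
    have hev : deriv (fun h => g (a * h)) =ᶠ[𝓝 (0 : ℂ)] fun h => a * deriv g (a * h) := by
      filter_upwards [hga] with h hh
      have hcomp : HasDerivAt (fun h => g (a * h)) (deriv g (a * h) * a) h :=
        (hh.differentiableAt.hasDerivAt).comp h (by simpa using (hasDerivAt_id h).const_mul a)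
      rw [hcomp.deriv, mul_comm]
    have hdg : AnalyticAt ℂ (deriv g) 0 := hg.deriv
    have hdga : AnalyticAt ℂ (fun h => deriv g (a * h)) 0 := by
      have h := hdg
      rw [← mul_zero a] at h
      exact h.comp ((analyticAt_const).mul analyticAt_id)
    rw [iteratedDeriv_succ', hev.iteratedDeriv_eq, iteratedDeriv_const_mul _ hdga.contDiffAt,
      ih (deriv g) hdg a, ← iteratedDeriv_succ']
    ring

/-- `log ∘ cosh` is analytic at `0`. [folklore] -/
theorem analyticAt_log_cosh : AnalyticAt ℂ (fun z => log (cosh z)) 0 :=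
  (differentiable_cosh.analyticAt 0).clog (by simp)

/-- **The cumulants of `X` at zero coupling**: `κ_{n}(X; 0) = (Σ_u λ_uⁿ) (log cosh)^{(n)}(0)` for
`n ≥ 1` (independent spins: `log⟨e^{hX}⟩_0 = Σ_u log cosh(λ_u h)`). [folklore] -/
theorem cumulant_weightedMagnetization_zero_coupling (lam : ι → ℝ) (n : ℕ) :
    ((cumulantOf (fun m => avg (0 : ι → ι → ℝ) (fun σ => weightedMagnetization lam σ ^ m))
        (n + 1) : ℝ) : ℂ) =
      (∑ u : ι, (lam u : ℂ) ^ (n + 1)) * iteratedDeriv (n + 1) (fun z => log (cosh z)) 0 := by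
  set L : ℂ → ℂ := fun h => ∑ u : ι, log (cosh ((lam u : ℂ) * h)) with hL
  have hf : AnalyticAt ℂ (mgf (0 : ι → ι → ℝ) lam) 0 := (differentiable_mgf 0 lam).analyticAt 0
  have hLu : ∀ u : ι, AnalyticAt ℂ (fun h => log (cosh ((lam u : ℂ) * h))) 0 := by
    intro u
    have h := analyticAt_log_cosh
    rw [← mul_zero (lam u : ℂ)] at h
    exact h.comp ((analyticAt_const).mul analyticAt_id)
  have hLan : AnalyticAt ℂ L 0 := by
    rw [hL]
    exact Finset.analyticAt_fun_sum _ fun u _ => hLu u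
  have hfL : ∀ᶠ z in 𝓝 0, mgf (0 : ι → ι → ℝ) lam z = exp (L z) := by
    have hne : ∀ u : ι, ∀ᶠ z in 𝓝 (0 : ℂ), cosh ((lam u : ℂ) * z) ≠ 0 := by
      intro u
      have ht : Tendsto (fun z : ℂ => (lam u : ℂ) * z) (𝓝 0) (𝓝 0) := by
        simpa using (continuous_const_mul (lam u : ℂ)).tendsto (0 : ℂ)
      exact ht.eventually eventually_cosh_ne_zero
    filter_upwards [eventually_all.2 hne] with z hz
    rw [mgf_zero_coupling, hL]
    dsimp only
    rw [exp_sum]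
    exact prod_congr rfl fun u _ => (exp_log (hz u)).symm
  have key := iteratedDeriv_succ_eq_cumulantOf hf hLan hfL (mgf_zero 0 lam) n
  simp_rw [iteratedDeriv_mgf_zero] at key
  rw [cumulantOf_ofReal _ (by simp [avg_const]) (Nat.succ_pos n)] at key
  rw [← key, hL, iteratedDeriv_fun_sum (fun u _ => (hLu u).contDiffAt), sum_mul]
  refine sum_congr rfl fun u _ => ?_
  have hsc := iteratedDeriv_comp_const_mul_of_analyticAt (n + 1) (fun z => log (cosh z))
    analyticAt_log_cosh (lam u : ℂ)
  simpa only using hsc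

/-- **Shlosman's sign at zero coupling** (the base point of CJN Remark 1): for `k ≥ 1`,
`(-1)^{k-1} κ_{2k}(X; 0) ≥ 0`. [cite: CamiaJiangNewman2023, §1.1 eq. (6)] -/
theorem cumulant_weightedMagnetization_zero_coupling_nonneg (lam : ι → ℝ) {k : ℕ} (hk : 1 ≤ k) :
    0 ≤ (-1 : ℝ) ^ (k - 1) *
      cumulantOf (fun m => avg (0 : ι → ι → ℝ) (fun σ => weightedMagnetization lam σ ^ m)) (2 * k) := by
  obtain ⟨r, hr0, hr⟩ := exists_iteratedDeriv_log_cosh_eq k hk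
  obtain ⟨j, rfl⟩ : ∃ j, k = j + 1 := ⟨k - 1, by omega⟩
  have key := cumulant_weightedMagnetization_zero_coupling lam (2 * j + 1)
  rw [show 2 * j + 1 + 1 = 2 * (j + 1) by ring] at key
  have hr' : (-1 : ℂ) ^ j * iteratedDeriv (2 * (j + 1)) (fun z => log (cosh z)) 0 = (r : ℂ) := by
    simpa using hr
  have hreal : (((-1 : ℝ) ^ (j + 1 - 1) * cumulantOf
      (fun m => avg (0 : ι → ι → ℝ) (fun σ => weightedMagnetization lam σ ^ m)) (2 * (j + 1)) : ℝ) : ℂ) =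
      (((∑ u : ι, lam u ^ (2 * (j + 1))) * r : ℝ) : ℂ) := by
    push_cast
    rw [key, mul_left_comm, hr']
  rw [Complex.ofReal_inj.1 hreal]
  exact mul_nonneg (sum_nonneg fun u _ => (even_two_mul (j + 1)).pow_nonneg (lam u)) hr0

end PairIsing

/-! ### Domination of the cumulants, given Theorem 1 -/

section Assembly

variable {ι : Type} [Fintype ι] [DecidableEq ι]

open PairIsing

/-- **`|κ_n(X; c)| ≤ |κ_n(X; c')|` for `0 ≤ c ≤ c'`, `λ ≥ 0`, `n ≥ 1`, given CJN Theorem 1**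
(odd `n`: both vanish; even `n = 2k`: `0 ≤ (-1)^{k-1}κ_{2k}(0) ≤ (-1)^{k-1}κ_{2k}(c) ≤
(-1)^{k-1}κ_{2k}(c')`). [cite: CamiaJiangNewman2023, Thm 1 and §1.2 (proof of Thm 2)] -/
theorem cumulant_abs_le_of_thm1 (h1 : CamiaJiangNewman2023_thm1) {c c' : ι → ι → ℝ}
    (hc : ∀ a b, 0 ≤ c a b) (hcc' : ∀ a b, c a b ≤ c' a b) {lam : ι → ℝ} (hlam : ∀ u, 0 ≤ lam u)
    {n : ℕ} (hn : 1 ≤ n) :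
    |cumulantOf (fun m => avg c (fun σ => weightedMagnetization lam σ ^ m)) n| ≤
      |cumulantOf (fun m => avg c' (fun σ => weightedMagnetization lam σ ^ m)) n| := by
  rcases Nat.even_or_odd' n with ⟨k, rfl | rfl⟩
  · have hk : 1 ≤ k := by omega
    have h0c := cumulant_weightedMagnetization_mono_of_thm1 h1 (c := 0) (c' := c)
      (fun _ _ => le_rfl) hc hlam hk
    have hcc := cumulant_weightedMagnetization_mono_of_thm1 h1 hc hcc' hlam hk
    have h00 := cumulant_weightedMagnetization_zero_coupling_nonneg lam hk (ι := ι)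
    have habs : ∀ x : ℝ, |x| = |(-1 : ℝ) ^ (k - 1) * x| := fun x => by
      rw [abs_mul, abs_pow, abs_neg, abs_one, one_pow, one_mul]
    rw [habs, habs (cumulantOf _ _), abs_of_nonneg (h00.trans h0c),
      abs_of_nonneg ((h00.trans h0c).trans hcc)]
    exact hcc
  · rw [cumulant_weightedMagnetization_odd, cumulant_weightedMagnetization_odd]

/-- A closed disc free of zeros of the (continuous) mgf thickens to an open zero-free disc.
[folklore] -/
theorem exists_ball_forall_mgf_ne_zero (c : ι → ι → ℝ) (lam : ι → ℝ) {r : ℝ} (hr : 0 ≤ r)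
    (h : ∀ z : ℂ, ‖z‖ ≤ r → mgf c lam z ≠ 0) :
    ∃ R : ℝ, r < R ∧ ∀ z ∈ ball (0 : ℂ) R, mgf c lam z ≠ 0 := by
  have hK : IsCompact (closedBall (0 : ℂ) r) := isCompact_closedBall 0 r
  have hU : IsOpen {z : ℂ | mgf c lam z ≠ 0} := isOpen_ne_fun (continuous_mgf c lam) continuous_const
  have hKU : closedBall (0 : ℂ) r ⊆ {z : ℂ | mgf c lam z ≠ 0} := fun z hz =>
    h z (by simpa using hz)
  obtain ⟨δ, hδ0, hδ⟩ := hK.exists_cthickening_subset_open hU hKU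
  refine ⟨r + δ, by linarith, fun z hz => ?_⟩
  have hz' : z ∈ cthickening δ (closedBall (0 : ℂ) r) := by
    rw [cthickening_closedBall hδ0.le hr]
    exact ball_subset_closedBall (by rwa [add_comm])
  exact hδ hz'

/-- **Camia–Jiang–Newman 2023, Theorem 2 from Theorem 1** (the deduction printed in §1.2): the
monotonicity of Ursell functions implies that the first Lee–Yang zero of `⟨exp[h Σ λ_u σ_u]⟩` is
antitone in the couplings, in the zero form of `CamiaJiangNewman2023_thm2`.
[cite: CamiaJiangNewman2023, Thm 2 (proof, §1.2)] -/
theorem CamiaJiangNewman2023_thm2_of_thm1 (h1 : CamiaJiangNewman2023_thm1) :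
    CamiaJiangNewman2023_thm2 := by
  intro ι _ _ c c' lam hc hcc' hlam h₀ hh₀
  by_contra hcon
  push Not at hcon
  -- `mgf_{c'}` has no zero of modulus `≤ ‖h₀‖`, hence none in a disc of radius `R > ‖h₀‖`
  have hfree : ∀ z : ℂ, ‖z‖ ≤ ‖h₀‖ → mgf c' lam z ≠ 0 := fun z hz hz0 =>
    absurd hz (not_le.2 (hcon z hz0))
  obtain ⟨R, hR, hR0⟩ := exists_ball_forall_mgf_ne_zero c' lam (norm_nonneg h₀) hfree
  have hRpos : 0 < R := (norm_nonneg h₀).trans_lt hR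
  -- a holomorphic logarithm `Lg` of `mgf_{c'}` on the disc
  have hgd : DifferentiableOn ℂ (mgf c' lam) (ball 0 R) := (differentiable_mgf c' lam).differentiableOn
  obtain ⟨Lg, hLgd, hLg⟩ := Complex.exists_eq_exp_of_forall_isExactOn isOpen_ball
    (convex_ball (0 : ℂ) R).isPreconnected (fun f hf => hf.isExactOn_ball) hgd hR0
  have hLgan : AnalyticAt ℂ Lg 0 := hLgd.analyticAt (isOpen_ball.mem_nhds (mem_ball_self hRpos))
  have hgL : ∀ᶠ z in 𝓝 0, mgf c' lam z = exp (Lg z) := by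
    filter_upwards [isOpen_ball.mem_nhds (mem_ball_self hRpos)] with z hz
    exact hLg z hz
  have hLg_coeff : ∀ n, iteratedDeriv (n + 1) Lg 0 =
      ((cumulantOf (fun m => avg c' (fun σ => weightedMagnetization lam σ ^ m)) (n + 1) : ℝ) : ℂ) := by
    intro n
    rw [iteratedDeriv_succ_eq_cumulantOf ((differentiable_mgf c' lam).analyticAt 0) hLgan hgL
      (mgf_zero c' lam) n]
    simp_rw [iteratedDeriv_mgf_zero]
    exact cumulantOf_ofReal _ (by simp [avg_const]) (Nat.succ_pos n)
  -- the local logarithm `Lf = log ∘ mgf_c` at `0`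
  have hfan : AnalyticAt ℂ (mgf c lam) 0 := (differentiable_mgf c lam).analyticAt 0
  have hLf : AnalyticAt ℂ (fun h => log (mgf c lam h)) 0 :=
    hfan.clog (by rw [mgf_zero]; exact one_mem_slitPlane)
  have hfL : ∀ᶠ z in 𝓝 0, mgf c lam z = exp (log (mgf c lam z)) := by
    have hne : ∀ᶠ z in 𝓝 (0 : ℂ), mgf c lam z ≠ 0 :=
      (continuous_mgf c lam).continuousAt.eventually_ne (by rw [mgf_zero]; exact one_ne_zero)
    filter_upwards [hne] with z hz
    rw [exp_log hz]
  -- domination of the Taylor coefficients of the logarithms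
  have hdom : ∀ n, 1 ≤ n → ‖iteratedDeriv n (fun h => log (mgf c lam h)) 0‖ ≤ ‖iteratedDeriv n Lg 0‖ := by
    intro n hn
    obtain ⟨m, rfl⟩ : ∃ m, n = m + 1 := ⟨n - 1, by omega⟩
    rw [iteratedDeriv_log_mgf, hLg_coeff, Complex.norm_real, Complex.norm_real, Real.norm_eq_abs,
      Real.norm_eq_abs]
    exact cumulant_abs_le_of_thm1 h1 hc hcc' hlam hn
  -- conclusion: `mgf_c` has no zero in the disc, contradicting `mgf_c h₀ = 0`
  have hh₀R : h₀ ∈ ball (0 : ℂ) R := by simpa using hR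
  exact ne_zero_of_norm_iteratedDeriv_le (differentiable_mgf c lam).differentiableOn hLf hfL hLgd
    hdom hh₀R hh₀

end Assembly

end Literature.Probability.LatticeModels
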